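import Summits.BirchSwinnertonDyer.BirchSwinnertonDyer.Theorems.Rank2Observatory2DescClClassGen
import Summits.BirchSwinnertonDyer.BirchSwinnertonDyer.Theorems.Rank2Observatory2DescClIndexCertPrime
import Summits.BirchSwinnertonDyer.BirchSwinnertonDyer.Theorems.Rank2Observatory2DescSignature
import Mathlib.Tactic.NormNum.GCD
import HarnessLib

/-!
# Class-group generation sweep for NON-monogenic cubic fields: the bound from `gcd` of two generators' discriminants

HONEST FRAMING: per-curve certified theorems and census instruments; no claim on BSD in rank ≥ 2.

KERNEL-2DESC-CL cut 2c-A (cert-1 gen 14). The sweep lemma `TwoDescCl.eq_top_of_classIn_lt` runs below a bound `b`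
with `64·|Δ(F)| < 799·b²`, using `|d_K| ≤ |Δ(F)|`. For a field presented by a census generator `α` of index
`i = [𝓞 K : ℤ[α]] > 1` this wastes a factor `i` in `b` (`Δ(F) = i²·d_K`; `i ≤ 18` in the rank-2 census, sweep bounds up
to `7001` instead of `≤ 400`). With a SECOND generator `η` (minimal cubic `F'`), `d_K` divides both `Δ(F)` and `Δ(F')`,
so `|d_K| ≤ gcd(Δ(F), Δ(F'))` — and the gcd IS `|d_K|` as soon as the two indices are coprime, which is how the cut-2c
generator chooses `η`. This file: `discr_dvd_disc`, `abs_discr_le_gcd_disc`, the generator-free sweep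
`eq_top_of_classIn_lt_discr` (hypothesis on `|d_K|` itself) and the two-generator sweep `eq_top_of_classIn_lt_gcd`
(hypothesis `64·gcd(Δ(F), Δ(F')) < 799·b²`, discharged by `norm_num` in the field files).
Mathematics: Marcus, *Number Fields*, Ch. 2 Ex. 27 (Δ = index²·d_K), Ch. 5 Cor. 2 of Thm. 37 (Minkowski). [folklore]
-/

-- single-conjunct summit: `Summit.BirchSwinnertonDyer.BirchSwinnertonDyer.…` repeats the name by design
set_option linter.dupNamespace false

noncomputable section

open scoped NumberField nonZeroDivisors

namespace Summit.BirchSwinnertonDyer.BirchSwinnertonDyer.Rank2Observatory.TwoDescCl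

open IsDedekindDomain NumberField Ideal Polynomial Module
open Literature.NumberTheory.NumberFields

variable {K : Type*} [Field K] [NumberField K]

/-- `d_K ∣ Δ(F)` for any integral generator: `Δ(F) = [𝓞 K : ℤ[θ]]²·d_K`. [cite: Marcus2018, Ch. 2, Ex. 27] -/
theorem discr_dvd_disc {A B C : ℤ} {θ : K} (hirr : Irreducible (MonicCubic.polyQ A B C))
    (hθ : aeval θ (MonicCubic.poly A B C) = 0) (h3 : finrank ℚ K = 3) :
    NumberField.discr K ∣ MonicCubic.disc A B C :=
  Dvd.intro_left _ (TwoDescCubic.disc_eq_indexDet_sq_mul_discr hirr hθ h3).symm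

/-- **Two generators bound the field discriminant by a gcd**: `|d_K| ≤ gcd(Δ(F), Δ(F'))`. [cite: Marcus2018, Ch. 2, Ex. 27] -/
theorem abs_discr_le_gcd_disc {A B C A' B' C' : ℤ} {θ θ' : K}
    (hirr : Irreducible (MonicCubic.polyQ A B C)) (hθ : aeval θ (MonicCubic.poly A B C) = 0)
    (hirr' : Irreducible (MonicCubic.polyQ A' B' C')) (hθ' : aeval θ' (MonicCubic.poly A' B' C') = 0)
    (h3 : finrank ℚ K = 3) :
    |NumberField.discr K| ≤ (Int.gcd (MonicCubic.disc A B C) (MonicCubic.disc A' B' C') : ℤ) := by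
  have hg : NumberField.discr K ∣ (Int.gcd (MonicCubic.disc A B C) (MonicCubic.disc A' B' C') : ℤ) :=
    Int.dvd_coe_gcd (discr_dvd_disc hirr hθ h3) (discr_dvd_disc hirr' hθ' h3)
  have hpos : (0 : ℤ) < (Int.gcd (MonicCubic.disc A B C) (MonicCubic.disc A' B' C') : ℤ) := by
    exact_mod_cast Int.gcd_pos_of_ne_zero_left _ (disc_ne_zero hirr hθ h3)
  exact Int.le_of_dvd hpos ((abs_dvd _ _).mpr hg)

/-- **Sweep below the Minkowski bound, generator-free form**: hypothesis on `|d_K|` itself.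
[cite: Marcus2018, Ch. 5, Cor. 2 of Thm. 37] -/
theorem eq_top_of_classIn_lt_discr (h3 : finrank ℚ K = 3) {b : ℕ}
    (hdK : 64 * |NumberField.discr K| < 799 * (b : ℤ) ^ 2) {H : Subgroup (ClassGroup (𝓞 K))}
    (h : ∀ p : ℕ, p < b → p.Prime → ∀ P ∈ primesOver (span {(p : ℤ)}) (𝓞 K),
      p ^ P.inertiaDeg ℤ < b → ClassIn H P) : H = ⊤ := by
  have hM := TwoDescCubic.minkowskiBound_lt h3 hdK
  have hfloor : ⌊(4 / Real.pi) ^ InfinitePlace.nrComplexPlaces K *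
      ((finrank ℚ K).factorial / (finrank ℚ K : ℝ) ^ finrank ℚ K * √|(discr K : ℝ)|)⌋₊ < b := by
    refine (Nat.floor_lt (by positivity)).mpr ?_
    exact_mod_cast hM
  refine classGroup_eq_top_of_classIn fun p hp hprime P hP hle => ?_
  have hpb : p < b := lt_of_le_of_lt (Finset.mem_Icc.mp hp).2 hfloor
  exact h p hpb hprime P hP (lt_of_le_of_lt hle hfloor)

/-- **Sweep below the Minkowski bound from two generators**: `64·gcd(Δ(F), Δ(F')) < 799·b²` suffices (cut 2c-A: the
census generator `α` and an auxiliary generator `η` of coprime index). [cite: Marcus2018, Ch. 5, Cor. 2 of Thm. 37] -/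
theorem eq_top_of_classIn_lt_gcd {A B C A' B' C' : ℤ} {θ θ' : K}
    (hirr : Irreducible (MonicCubic.polyQ A B C)) (hθ : aeval θ (MonicCubic.poly A B C) = 0)
    (hirr' : Irreducible (MonicCubic.polyQ A' B' C')) (hθ' : aeval θ' (MonicCubic.poly A' B' C') = 0)
    (h3 : finrank ℚ K = 3) {b : ℕ}
    (hd : 64 * (Int.gcd (MonicCubic.disc A B C) (MonicCubic.disc A' B' C') : ℤ) < 799 * (b : ℤ) ^ 2)
    {H : Subgroup (ClassGroup (𝓞 K))}
    (h : ∀ p : ℕ, p < b → p.Prime → ∀ P ∈ primesOver (span {(p : ℤ)}) (𝓞 K),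
      p ^ P.inertiaDeg ℤ < b → ClassIn H P) : H = ⊤ :=
  eq_top_of_classIn_lt_discr h3
    (lt_of_le_of_lt (by linarith [abs_discr_le_gcd_disc hirr hθ hirr' hθ' h3]) hd) h

end Summit.BirchSwinnertonDyer.BirchSwinnertonDyer.Rank2Observatory.TwoDescCl

end
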